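import Summits.CriticalPhenomena.PercolationContinuityZ3.Theorems.Transplant.SkelNeg1ChoiceAll
import HarnessLib

/-!
# N1 params, part 4b: THE CHOICE FUNCTION WITH AN EXTENSIBLE PAIR LIST — `PlanarSkeletonNeg.negChoiceAllOP fv Pv Sv : ChoiceFnNO`, the same choices of record as
# `negChoiceAllOF fv Sv` (part 4) except that the admissible-pairs list is `SMn ∪ (Pv …).1`, where the third slot `Pv : Neg.PSlot` supplies ANY finite set of EXTRA admissible
# pairs `(M, n)` WITH their admissibility proof — so the (R) bridge pair `(M_u, n_b)` (N1-R-PLAN v2 (R-F2), stmt-g13 option (b″)) and the kit layer's link pair `(M_kit, n_kit)`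
# (p1-g11 2026-08-21T15:35:14Z) enter by ONE slot value, with no further re-version of the choice function; plus the generic unpacking `inputsP_of_atQO` for every extra pair

builds on p205010 (kernel theorem, internal audit signed; external expert review pending) — nothing in this file uses p205010; NOTHING is claimed about
the node `SamePDropOfSkeletonNeg₁` (OPEN): this file discharges the geometric obligation of `samePDropOfSkeletonNeg₁_of_choiceFnNO` for the extensible choices of record
(`geomHoldsNOFn_negChoiceAllOP`), for every slot value; (R)/(F)/(C) are the residue seats'.
Status sentence (coordinator 2026-08-20T04:30Z): "θ(p_c) = 0 on ℤ^d, all d ≥ 2 — kernel-verified (Lean 4/Mathlib, standard axioms); internal adversarial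
audit SIGNED 2026-08-20 04:29Z; external expert review pending."
Lane `prim-bschramm-*`, seat `prim-bschramm-stmt` (gen 13); helper file (`--supports stmt-CriticalPhenomena-4575 --as helper`); ledger HOME/prim-bschramm-stmt/NEG-PARAMS.md v0.9;
interface of record = p3's `ChoiceNO` (p282003).  Step I″-O serves ANY finite pair list (`exists_stepI_negO_indexP`), so extra pairs cost nothing at LEVEL 0.
* §1 `Neg.PSlot` (extra admissible pairs as a function of the p-fixed data, bundled with admissibility), `Neg.SMnP` (`SMn ∪ extra`), `SMn_subset_SMnP`, `extra_subset_SMnP`, `SMnP_adm_at`,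
  `Neg.choiceAtOP`, **`negChoiceAllOP`** (+ `_eq`);
* §2 unpacking `AtQO`: `factsO/eqNumL/clauseL/clauseS/inputsS/inputsL/zone _of_atQOP` and **`inputsP_of_atQOP`** (the eight piece-links of ANY extra pair `(M, n) ∈ (Pv …).1` at the
  oriented map `oriφ Φ.φ (ori t M n)` over the merged record), `clauseP_of_atQOP` (its geometric clause + `|h| ≤ 10 n`);
* §3 **`geomHoldsNOFn_negChoiceAllOP : ∀ fv Pv Sv, GeomHoldsNOFn (negChoiceAllOP fv Pv Sv)`**.
[cite: KozmaNitzan2024, §4 Theorem 6 (pp. 25–31): the order of constants] [cite: MartineauTassion2017, §3.2 Lemma 3.5]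
-/

noncomputable section

open scoped Classical

namespace Summit.CriticalPhenomena.PercolationContinuityZ3.Theorems.Transplant

open MeasureTheory Literature.Probability.Percolation Literature.Probability.LatticeModels SimpleGraph KNCells
open Literature.Barriers.CriticalPhenomena (HasExponentialGrowth)

namespace PlanarSkeletonNeg

open SkelConc (Consts)
open BoxProdZ2 (ConcRadiiG)
open Skelφ (oriφ trφ)
open Skelφ.StepI (DataN OutO)

namespace Neg

/-! ## §1 The pair slot and the extensible choices -/

/-- **A pair slot**: a finite set of EXTRA admissible pairs `(M, n)` (`D.M₀ ≤ M`, `D.n₁ M ≤ n`) as a function of the p-fixed data, bundled with its admissibility. [this work] -/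
def PSlot : Type 1 :=
  ∀ (κ : Consts) {V : Type} [DecidableEq V] [Countable V] {G : SimpleGraph V} [G.LocallyFinite], PlanarSkeletonNeg G → V → unitInterval →
    ∀ D : DataN V, {S : Finset (ℕ × ℕ) // ∀ q ∈ S, D.M₀ ≤ q.1 ∧ D.n₁ q.1 ≤ q.2}

/-- The empty pair slot (recovers `negChoiceAllOF`'s list). [folklore] -/
def PSlot.empty : PSlot := fun _ _ _ _ _ _ _ _ _ _ => ⟨∅, fun _ h => absurd h (Finset.notMem_empty _)⟩

section Values

variable (κ : Consts) {V : Type} [DecidableEq V] [Countable V] {G : SimpleGraph V} [G.LocallyFinite] (Φ : PlanarSkeletonNeg G) (t : V)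
  (p : unitInterval) (D : DataN V) (f : ℕ) (Pv : PSlot)

/-- **The extensible pair list**: `SMn ∪ extra`. [this work] -/
def SMnP : Finset (ℕ × ℕ) := SMn κ Φ t p D f ∪ (Pv κ Φ t p D).1

/-- The two ledger pairs are in the extensible list. [folklore] -/
theorem SMn_subset_SMnP : SMn κ Φ t p D f ⊆ SMnP κ Φ t p D f Pv := Finset.subset_union_left

/-- The extra pairs are in the extensible list. [folklore] -/
theorem extra_subset_SMnP : (Pv κ Φ t p D).1 ⊆ SMnP κ Φ t p D f Pv := Finset.subset_union_right

/-- **Pair admissibility of the extensible list** (the OBLIGATION's second conjunct). [folklore] -/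
theorem SMnP_adm_at : ∀ q ∈ SMnP κ Φ t p D f Pv, D.M₀ ≤ q.1 ∧ D.n₁ q.1 ≤ q.2 := by
  intro q hq
  rcases Finset.mem_union.1 hq with h | h
  · exact SMn_adm_at κ Φ t p D f q h
  · exact (Pv κ Φ t p D).2 q h

variable (O : OutO V) (fv : FSlot) (Sv : SSlot) (q : unitInterval) (hC : Φ.CylSubcritical p)

/-- **THE N1 CHOICES OF RECORD with the extensible pair list**: as `choiceAtOF`, with `SMn O := SMnP … O.merged (fOf …) Pv`. [cite: KozmaNitzan2024, §4 Theorem 6 (pp. 25–31)] -/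
def choiceAtOP : ChoiceNO κ Φ t p hC where
  δI := Neg.δI κ Φ
  m₀ := Neg.m₀
  Sz := fun O => Neg.Sz O.merged
  SMn := fun O => SMnP κ Φ t p O.merged (fOf κ Φ t p O fv) Pv
  Γ := fun O q => ΓO κ Φ t p O fv Sv q
  FD := fun O q => FDO κ Φ t p O fv Sv q
  LD := fun O _ => LDO κ Φ t p O fv
  δI_pos := Neg.δI_pos κ Φ
  δI_lt_one := Neg.δI_lt_one κ Φ
  S_adm := fun O _ => ⟨Neg.Sz_adm O.merged, SMnP_adm_at κ Φ t p O.merged _ Pv⟩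

end Values

end Neg

/-- **THE CHOICE FUNCTION OF THE {±1} NODE, three slots** (width clearance `fv`, extra pairs `Pv`, fibre block `Sv`). [cite: KozmaNitzan2024, §4 Theorem 6 (pp. 25–31)] -/
def negChoiceAllOP (fv : Neg.FSlot) (Pv : Neg.PSlot) (Sv : Neg.SSlot) : ChoiceFnNO :=
  fun κ _ _ _ _ _ Φ _ t _ _ p _ _ hC => Neg.choiceAtOP κ Φ t p Pv fv Sv hC

/-- `negChoiceAllOP` unfolds to `Neg.choiceAtOP` (by `rfl`). [folklore] -/
theorem negChoiceAllOP_eq (fv : Neg.FSlot) (Pv : Neg.PSlot) (Sv : Neg.SSlot) (κ : Consts) {V : Type} [DecidableEq V] [Countable V] (G : SimpleGraph V)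
    [G.LocallyFinite] (Φ : PlanarSkeletonNeg G) (hg : ¬ HasExponentialGrowth G) (t : V) (ht : t ∈ Φ.types) (h1 : Φ.types = {t}) (p : unitInterval)
    (hp0 : 0 < (p : ℝ)) (hp1 : (p : ℝ) < 1) (hC : Φ.CylSubcritical p) :
    negChoiceAllOP fv Pv Sv κ G Φ hg t ht h1 p hp0 hp1 hC = Neg.choiceAtOP κ Φ t p Pv fv Sv hC := rfl

/-! ## §2 Unpacking `AtQO` for the extensible choices -/

namespace Neg

section AtQP

variable {κ : Consts} {V : Type} [DecidableEq V] [Countable V] {G : SimpleGraph V} [G.LocallyFinite] {Φ : PlanarSkeletonNeg G} {t : V} {p : unitInterval}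
  {hC : Φ.CylSubcritical p} {fv : FSlot} {Pv : PSlot} {Sv : SSlot} {O : OutO V} {q : unitInterval}

/-- `FactsO`, the density window and Φ2 at `q` out of `AtQO`. [folklore] -/
theorem factsO_of_atQOP (hAt : (choiceAtOP κ Φ t p Pv fv Sv hC).AtQO O q) :
    O.FactsO Φ.frame hC Neg.m₀ t ∧ (p : ℝ) / 2 ≤ q ∧ (q : ℝ) ≤ p ∧ Φ.CylSubcritical q := ⟨hAt.1, hAt.2.1, hAt.2.2.1, hAt.2.2.2.2⟩

/-- **The numeric long clause at the merged record** out of `AtQO`. [this work] -/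
theorem eqNumL_of_atQOP (hAt : (choiceAtOP κ Φ t p Pv fv Sv hC).AtQO O q) : EqNumL κ Φ t p O.merged (fOf κ Φ t p O fv) :=
  eqNumL_of_factsO κ Φ t p O.D O.DT O.ori _ hAt.1.shared.2.2.1 hAt.1.clauses

/-- **The long clause (oriented map `φL`, `|h_L| ≤ 10 n_L`)** out of `AtQO`. [this work] -/
theorem clauseL_of_atQOP (hAt : (choiceAtOP κ Φ t p Pv fv Sv hC).AtQO O q) :
    O.merged.EqGeom G (φL κ Φ t p O.D O.DT O.ori (fOf κ Φ t p O fv)) t (ML κ Φ t p O.merged) (nL κ Φ t p O.merged (fOf κ Φ t p O fv)) ∧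
      (hL κ Φ t p O.merged (fOf κ Φ t p O fv)).natAbs ≤ 10 * nL κ Φ t p O.merged (fOf κ Φ t p O fv) :=
  clauseL_of_factsO κ Φ t p O.D O.DT O.ori _ hAt.1.shared.2.2.1 hAt.1.clauses

/-- **The short clause (oriented map `φS`, `|h_s| ≤ 10 n_s`)** out of `AtQO`. [this work] -/
theorem clauseS_of_atQOP (hAt : (choiceAtOP κ Φ t p Pv fv Sv hC).AtQO O q) :
    O.merged.EqGeom G (φS t O.D O.DT O.ori (Φ := Φ)) t (Mu O.merged) (nS O.merged) ∧ (hS t O.merged).natAbs ≤ 10 * nS O.merged :=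
  clauseS_of_factsO Φ t O.D O.DT O.ori hAt.1.shared.2.2.1 hAt.1.clauses

/-- **The clause of ANY admissible pair** (in particular every extra pair): `O.merged.EqGeom G (oriφ Φ.φ (O.ori t M n)) t M n ∧ |h(t,M,n)| ≤ 10 n`. [this work] -/
theorem clauseP_of_atQOP (hAt : (choiceAtOP κ Φ t p Pv fv Sv hC).AtQO O q) {M n : ℕ} (hM : O.D.M₀ ≤ M) (hn : O.D.n₁ M ≤ n) :
    O.merged.EqGeom G (oriφ Φ.φ (O.ori t M n)) t M n ∧ (O.merged.hgt t M n).natAbs ≤ 10 * n :=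
  Skelφ.StepI.orient_clause_all hAt.1.shared.2.2.1 hAt.1.clauses M hM n hn

/-- **THE PIECE-LINKS OF ANY LISTED PAIR at `q`**: for `(M, n) ∈ SMnP`, the eight inputs at the oriented map over the merged record, accuracy `δI`. [this work] -/
theorem inputsP_of_atQOP (hAt : (choiceAtOP κ Φ t p Pv fv Sv hC).AtQO O q) {M n : ℕ} (hMn : (M, n) ∈ SMnP κ Φ t p O.merged (fOf κ Φ t p O fv) Pv)
    (fam : Fin 2) (σ τ : ℤˣ) :
    1 - Neg.δI κ Φ < (bondPercolation G q).real (Skelφ.StepI.eventN G (oriφ Φ.φ (O.ori t M n)) O.merged (t, M, some (n, fam, σ, τ))) := by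
  obtain ⟨hΛ, hk, hR, -, -⟩ := hAt.1.shared
  have ht : t ∈ ({t} : Finset V) := Finset.mem_singleton_self t
  have hmem := Skelφ.StepI.mem_indexNP_some (Sz := Neg.Sz O.merged) ht hMn fam σ τ
  have h := hAt.2.2.2.1 _ hmem
  rwa [Skelφ.StepI.eventO_some_eq_eventN_orient Φ.φ hΛ hk hR] at h

/-- **The extra pairs' piece-links**: for `(M, n) ∈ (Pv …).1`. [this work] -/
theorem inputsExtra_of_atQOP (hAt : (choiceAtOP κ Φ t p Pv fv Sv hC).AtQO O q) {M n : ℕ} (hMn : (M, n) ∈ (Pv κ Φ t p O.merged).1) (fam : Fin 2) (σ τ : ℤˣ) :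
    1 - Neg.δI κ Φ < (bondPercolation G q).real (Skelφ.StepI.eventN G (oriφ Φ.φ (O.ori t M n)) O.merged (t, M, some (n, fam, σ, τ))) :=
  inputsP_of_atQOP hAt (extra_subset_SMnP κ Φ t p O.merged _ Pv hMn) fam σ τ

/-- **The short pair's piece-links** (`φS = oriφ Φ.φ (ori t M_u n_s)`). [this work] -/
theorem inputsS_of_atQOP (hAt : (choiceAtOP κ Φ t p Pv fv Sv hC).AtQO O q) (fam : Fin 2) (σ τ : ℤˣ) :
    1 - Neg.δI κ Φ <
      (bondPercolation G q).real (Skelφ.StepI.eventN G (φS t O.D O.DT O.ori (Φ := Φ)) O.merged (t, Mu O.merged, some (nS O.merged, fam, σ, τ))) :=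
  inputsP_of_atQOP hAt (SMn_subset_SMnP κ Φ t p O.merged _ Pv (mem_SMn κ Φ t p O.merged (fOf κ Φ t p O fv)).1) fam σ τ

/-- **The long pair's piece-links** (`φL = oriφ Φ.φ (ori t M_L (n_L f))`). [this work] -/
theorem inputsL_of_atQOP (hAt : (choiceAtOP κ Φ t p Pv fv Sv hC).AtQO O q) (fam : Fin 2) (σ τ : ℤˣ) :
    1 - Neg.δI κ Φ <
      (bondPercolation G q).real (Skelφ.StepI.eventN G (φL κ Φ t p O.D O.DT O.ori (fOf κ Φ t p O fv)) O.merged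
        (t, ML κ Φ t p O.merged, some (nL κ Φ t p O.merged (fOf κ Φ t p O fv), fam, σ, τ))) :=
  inputsP_of_atQOP hAt (SMn_subset_SMnP κ Φ t p O.merged _ Pv (mem_SMn κ Φ t p O.merged (fOf κ Φ t p O fv)).2) fam σ τ

/-- **The uniqueness zone at `M_u`** (as the merged record's zone input, any map). [this work] -/
theorem zone_of_atQOP (hAt : (choiceAtOP κ Φ t p Pv fv Sv hC).AtQO O q) :
    1 - Neg.δI κ Φ < (bondPercolation G q).real (Skelφ.StepI.eventN G (φS t O.D O.DT O.ori (Φ := Φ)) O.merged (t, Mu O.merged, none)) := by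
  have ht : t ∈ ({t} : Finset V) := Finset.mem_singleton_self t
  have hmem := Skelφ.StepI.mem_indexNP_none (SMn := SMnP κ Φ t p O.merged (fOf κ Φ t p O fv) Pv) ht (Mu_mem_Sz O.merged)
  have h := hAt.2.2.2.1 _ hmem
  rw [Skelφ.StepI.eventO_none_eq_eventN Φ.φ (φS t O.D O.DT O.ori (Φ := Φ))] at h
  exact h

end AtQP

end Neg

/-! ## §3 The geometric obligation -/

/-- **`GeomHoldsNOFn (negChoiceAllOP fv Pv Sv)` FOR EVERY SLOT VALUE** (same scheme of record as part 4). [cite: KozmaNitzan2024, §4 pp. 25–29] -/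
theorem geomHoldsNOFn_negChoiceAllOP (fv : Neg.FSlot) (Pv : Neg.PSlot) (Sv : Neg.SSlot) : GeomHoldsNOFn (negChoiceAllOP fv Pv Sv) := by
  intro κ V _ _ G _ Φ hg t ht h1 p hp0 hp1 hC O q hAt
  obtain ⟨-, -, hR, -, -⟩ := hAt.1.shared
  obtain ⟨h1', h2, -, h4, h5, h6, h7, h8, h9⟩ := Neg.geom_fineO_of_factsO κ Φ t p O.D O.DT O.ori (Neg.fOf κ Φ t p O fv) hR hAt.1.clauses
    (Neg.schedOf_WFS2 κ Φ t p O.merged (Neg.fOf κ Φ t p O fv) (Sv κ Φ t p O.merged (Neg.fOf κ Φ t p O fv) q))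
    (Neg.colQ_schedOf κ Φ t p O.merged (Neg.fOf κ Φ t p O fv) (Sv κ Φ t p O.merged (Neg.fOf κ Φ t p O fv) q))
  exact ⟨h1', h2, h4, h5, h6, h7, h8, h9⟩

end PlanarSkeletonNeg

end Summit.CriticalPhenomena.PercolationContinuityZ3.Theorems.Transplant

end
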